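import Mathlib
import Summits.Ventures.PercRepro2.CoinOrTailAlg
import Summits.Ventures.PercRepro2.CoinK2HeadAwareAD

/-!
# The state × block cells of the head-aware two-entry OR-tail: Ahlswede–Daykin steps
(blind cell PercRepro2, night-2 g13; proofs/NIGHT2-DARC.md §48)

A cell is `Σ_{W ⊆ U} F W · (I W · J W)` with `F` a weight, `I` an entry-state indicator
`cellWt r₁ r₂ e₁ e₂` and `J` a marker factor (`1`, `mWt m true`, or the product of two).  Each
hypothesis of the block theorem `k2State_nonneg` is one `ad_indicator` step on such cells:
`cellBlk` (the block structure), `cellC` (within-state log-supermodularity), `cellT` (the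
within-state tilt), `cellGm` (the gate means along the state lattice), `cellLsm` (the state
masses), `cellR` (the ratio orderings), `cellLe` (domination), `cellTop`, `cellId`, `cellFil`
(the mean orderings of the `R`-law).  Pure sums, no probability.
-/

namespace Summit.Ventures.PercRepro2.Coin

open Classical

section K2AwareCells

variable {V : Type*} [DecidableEq V] {R : Type*} [Field R] [LinearOrder R] [IsStrictOrderedRing R]

omit [DecidableEq V] in
/-- Cells are nonnegative. -/
lemma cell_nonneg' (U : Finset V) (F I J : Finset V → R) (hF : ∀ W, 0 ≤ F W) (hI : ∀ W, 0 ≤ I W)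
    (hJ : ∀ W, 0 ≤ J W) : 0 ≤ ∑ W ∈ U.powerset, F W * (I W * J W) :=
  Finset.sum_nonneg fun W _ => mul_nonneg (hF W) (mul_nonneg (hI W) (hJ W))

/-- `mWt m true ≤ 1`. -/
lemma mWt_true_le_one (m : V) (W : Finset V) : mWt (R := R) m true W ≤ 1 := by
  unfold mWt; split_ifs <;> norm_num

/-- **The block structure of one state**: the marker masses dominate the joint mass and
inclusion–exclusion is bounded by the state mass. -/
theorem cellBlk (U : Finset V) (F I : Finset V → R) (m₁ m₂ : V) (hF : ∀ W, 0 ≤ F W)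
    (hI : ∀ W, 0 ≤ I W) :
    (∑ W ∈ U.powerset, F W * (I W * (mWt m₁ true W * mWt m₂ true W))) ≤
        ∑ W ∈ U.powerset, F W * (I W * mWt m₁ true W) ∧
    (∑ W ∈ U.powerset, F W * (I W * (mWt m₁ true W * mWt m₂ true W))) ≤
        ∑ W ∈ U.powerset, F W * (I W * mWt m₂ true W) ∧
    (∑ W ∈ U.powerset, F W * (I W * mWt m₁ true W)) + (∑ W ∈ U.powerset, F W * (I W * mWt m₂ true W))
        - (∑ W ∈ U.powerset, F W * (I W * (mWt m₁ true W * mWt m₂ true W))) ≤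
      ∑ W ∈ U.powerset, F W * (I W * 1) := by
  refine ⟨?_, ?_, ?_⟩
  · exact Finset.sum_le_sum fun W _ => by
      apply mul_le_mul_of_nonneg_left _ (hF W)
      apply mul_le_mul_of_nonneg_left _ (hI W)
      exact mul_le_of_le_one_right (mWt_nonneg _ _ _) (mWt_true_le_one _ _)
  · exact Finset.sum_le_sum fun W _ => by
      apply mul_le_mul_of_nonneg_left _ (hF W)
      apply mul_le_mul_of_nonneg_left _ (hI W)
      exact mul_le_of_le_one_left (mWt_nonneg _ _ _) (mWt_true_le_one _ _)
  · rw [← Finset.sum_add_distrib, ← Finset.sum_sub_distrib]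
    apply Finset.sum_le_sum
    intro W _
    have e : F W * (I W * mWt m₁ true W) + F W * (I W * mWt m₂ true W)
        - F W * (I W * (mWt m₁ true W * mWt m₂ true W))
        = F W * I W * (mWt m₁ true W + mWt m₂ true W - mWt m₁ true W * mWt m₂ true W) := by ring
    have e2 : F W * (I W * 1) = F W * I W * 1 := by ring
    rw [e, e2]
    apply mul_le_mul_of_nonneg_left _ (mul_nonneg (hF W) (hI W))
    nlinarith [mul_nonneg (sub_nonneg.2 (mWt_true_le_one (R := R) m₁ W))
      (sub_nonneg.2 (mWt_true_le_one (R := R) m₂ W))]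

/-- **Within-state log-supermodularity** of a weight `F` log-supermodular on `U`. -/
theorem cellC (U : Finset V) (F : Finset V → R) (r₁ r₂ m₁ m₂ : V) (e₁ e₂ : Bool)
    (hF : ∀ W, 0 ≤ F W) (hFF : ∀ s ⊆ U, ∀ t ⊆ U, F s * F t ≤ F (s ∩ t) * F (s ∪ t)) :
    (∑ W ∈ U.powerset, F W * (cellWt r₁ r₂ e₁ e₂ W * mWt m₁ true W)) *
        (∑ W ∈ U.powerset, F W * (cellWt r₁ r₂ e₁ e₂ W * mWt m₂ true W)) ≤
      (∑ W ∈ U.powerset, F W * (cellWt r₁ r₂ e₁ e₂ W * 1)) *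
        (∑ W ∈ U.powerset, F W * (cellWt r₁ r₂ e₁ e₂ W * (mWt m₁ true W * mWt m₂ true W))) := by
  refine ad_indicator U F F F F _ _ _ _ hF hF hF hF
    (fun W => mul_nonneg (cellWt_nonneg _ _ _ _ _) (mWt_nonneg _ _ _))
    (fun W => mul_nonneg (cellWt_nonneg _ _ _ _ _) (mWt_nonneg _ _ _))
    (fun W => mul_nonneg (cellWt_nonneg _ _ _ _ _) zero_le_one)
    (fun W => mul_nonneg (cellWt_nonneg _ _ _ _ _) (mul_nonneg (mWt_nonneg _ _ _) (mWt_nonneg _ _ _)))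
    (fun s t => ?_) (fun s hs t ht _ => hFF s hs t ht)
  simp only [mul_one]
  have := ind_state_two (R := R) r₁ r₂ m₁ m₂ e₁ e₂ s t
  calc cellWt (R := R) r₁ r₂ e₁ e₂ s * mWt m₁ true s * (cellWt r₁ r₂ e₁ e₂ t * mWt m₂ true t)
      ≤ _ := this
    _ = _ := by ring

/-- **The within-state tilt**: `x_e n_e ≤ l_e a_e` when the gate `G'` is Holley-above `G` at the
clusters of the state. -/
theorem cellT (U : Finset V) (G G' : Finset V → R) (r₁ r₂ m : V) (e₁ e₂ : Bool)
    (hG : ∀ W, 0 ≤ G W) (hG' : ∀ W, 0 ≤ G' W)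
    (wLM : ∀ s ⊆ U, ∀ t ⊆ U, cellWt (R := R) r₁ r₂ e₁ e₂ t ≠ 0 →
      G s * G' t ≤ G (s ∩ t) * G' (s ∪ t)) :
    (∑ W ∈ U.powerset, G W * (cellWt r₁ r₂ e₁ e₂ W * mWt m true W)) *
        (∑ W ∈ U.powerset, G' W * (cellWt r₁ r₂ e₁ e₂ W * 1)) ≤
      (∑ W ∈ U.powerset, G W * (cellWt r₁ r₂ e₁ e₂ W * 1)) *
        (∑ W ∈ U.powerset, G' W * (cellWt r₁ r₂ e₁ e₂ W * mWt m true W)) := by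
  refine ad_indicator U G G' G G' _ _ _ _ hG hG' hG hG'
    (fun W => mul_nonneg (cellWt_nonneg _ _ _ _ _) (mWt_nonneg _ _ _))
    (fun W => mul_nonneg (cellWt_nonneg _ _ _ _ _) zero_le_one)
    (fun W => mul_nonneg (cellWt_nonneg _ _ _ _ _) zero_le_one)
    (fun W => mul_nonneg (cellWt_nonneg _ _ _ _ _) (mWt_nonneg _ _ _))
    (fun s t => ?_) (fun s hs t ht hne => ?_)
  · simp only [mul_one]
    exact ind_state_marker r₁ r₂ m e₁ e₂ s t
  · apply wLM s hs t ht
    intro h0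
    apply hne
    rw [h0]; ring

/-- **The gate means along the state lattice**: between the states `e ≤ e'`. -/
theorem cellGm (U : Finset V) (F₁ F₂ : Finset V → R) (r₁ r₂ m : V) (e₁ e₂ e₁' e₂' : Bool)
    (hF₁ : ∀ W, 0 ≤ F₁ W) (hF₂ : ∀ W, 0 ≤ F₂ W)
    (hFF : ∀ s ⊆ U, ∀ t ⊆ U, cellWt (R := R) r₁ r₂ e₁' e₂' t ≠ 0 →
      F₁ s * F₂ t ≤ F₁ (s ∩ t) * F₂ (s ∪ t)) :
    (∑ W ∈ U.powerset, F₁ W * (cellWt r₁ r₂ e₁ e₂ W * mWt m true W)) *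
        (∑ W ∈ U.powerset, F₂ W * (cellWt r₁ r₂ e₁' e₂' W * 1)) ≤
      (∑ W ∈ U.powerset, F₁ W * (cellWt r₁ r₂ (e₁ && e₁') (e₂ && e₂') W * 1)) *
        (∑ W ∈ U.powerset, F₂ W * (cellWt r₁ r₂ (e₁ || e₁') (e₂ || e₂') W * mWt m true W)) := by
  refine ad_indicator U F₁ F₂ F₁ F₂ _ _ _ _ hF₁ hF₂ hF₁ hF₂
    (fun W => mul_nonneg (cellWt_nonneg _ _ _ _ _) (mWt_nonneg _ _ _))
    (fun W => mul_nonneg (cellWt_nonneg _ _ _ _ _) zero_le_one)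
    (fun W => mul_nonneg (cellWt_nonneg _ _ _ _ _) zero_le_one)
    (fun W => mul_nonneg (cellWt_nonneg _ _ _ _ _) (mWt_nonneg _ _ _))
    (fun s t => ?_) (fun s hs t ht hne => ?_)
  · simp only [mul_one]
    exact ind_two_states r₁ r₂ m e₁ e₂ e₁' e₂' s t
  · apply hFF s hs t ht
    intro h0
    apply hne
    rw [h0]; ring

/-- **The state masses are log-supermodular**: `l₁ l₂ ≤ l₀ l₃`. -/
theorem cellLsm (U : Finset V) (G : Finset V → R) (r₁ r₂ : V) (hG : ∀ W, 0 ≤ G W)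
    (wLL : ∀ s ⊆ U, ∀ t ⊆ U, G s * G t ≤ G (s ∩ t) * G (s ∪ t)) :
    (∑ W ∈ U.powerset, G W * (cellWt r₁ r₂ true false W * 1)) *
        (∑ W ∈ U.powerset, G W * (cellWt r₁ r₂ false true W * 1)) ≤
      (∑ W ∈ U.powerset, G W * (cellWt r₁ r₂ false false W * 1)) *
        (∑ W ∈ U.powerset, G W * (cellWt r₁ r₂ true true W * 1)) := by
  refine ad_indicator U G G G G _ _ _ _ hG hG hG hG
    (fun W => mul_nonneg (cellWt_nonneg _ _ _ _ _) zero_le_one)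
    (fun W => mul_nonneg (cellWt_nonneg _ _ _ _ _) zero_le_one)
    (fun W => mul_nonneg (cellWt_nonneg _ _ _ _ _) zero_le_one)
    (fun W => mul_nonneg (cellWt_nonneg _ _ _ _ _) zero_le_one)
    (fun s t => ?_) (fun s hs t ht _ => wLL s hs t ht)
  simp only [mul_one]
  have := cellWt_mul_le (R := R) r₁ r₂ true false false true s t
  simpa using this

/-- **The ratio orderings of the gate masses**: `n_e l₃ ≤ l_e n₃` for an entered state `e`. -/
theorem cellR (U : Finset V) (G G' : Finset V → R) (r₁ r₂ : V) (e₁ e₂ : Bool)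
    (hG : ∀ W, 0 ≤ G W) (hG' : ∀ W, 0 ≤ G' W)
    (wML : ∀ s ⊆ U, ∀ t ⊆ U, cellWt (R := R) r₁ r₂ e₁ e₂ s ≠ 0 →
      G' s * G t ≤ G (s ∩ t) * G' (s ∪ t)) :
    (∑ W ∈ U.powerset, G' W * (cellWt r₁ r₂ e₁ e₂ W * 1)) *
        (∑ W ∈ U.powerset, G W * (cellWt r₁ r₂ true true W * 1)) ≤
      (∑ W ∈ U.powerset, G W * (cellWt r₁ r₂ (e₁ && true) (e₂ && true) W * 1)) *
        (∑ W ∈ U.powerset, G' W * (cellWt r₁ r₂ (e₁ || true) (e₂ || true) W * 1)) := by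
  refine ad_indicator U G' G G G' _ _ _ _ hG' hG hG hG'
    (fun W => mul_nonneg (cellWt_nonneg _ _ _ _ _) zero_le_one)
    (fun W => mul_nonneg (cellWt_nonneg _ _ _ _ _) zero_le_one)
    (fun W => mul_nonneg (cellWt_nonneg _ _ _ _ _) zero_le_one)
    (fun W => mul_nonneg (cellWt_nonneg _ _ _ _ _) zero_le_one)
    (fun s t => ?_) (fun s hs t ht hne => ?_)
  · simp only [mul_one]
    exact cellWt_mul_le (R := R) r₁ r₂ e₁ e₂ true true s t
  · apply wML s hs t ht
    intro h0
    apply hne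
    rw [h0]; ring

omit [DecidableEq V] in
/-- **Domination**: the gate cells are at most the `R`-law cells. -/
theorem cellLe (U : Finset V) (G G' I J : Finset V → R) (hle : ∀ W, G' W ≤ G W)
    (hI : ∀ W, 0 ≤ I W) (hJ : ∀ W, 0 ≤ J W) :
    (∑ W ∈ U.powerset, G' W * (I W * J W)) ≤ ∑ W ∈ U.powerset, G W * (I W * J W) :=
  Finset.sum_le_sum fun W _ => mul_le_mul_of_nonneg_right (hle W) (mul_nonneg (hI W) (hJ W))

/-- **The top mean ordering** of the `R`-law. -/
theorem cellTop (U : Finset V) (G : Finset V → R) (r₁ r₂ m : V) (hG : ∀ W, 0 ≤ G W)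
    (wLL : ∀ s ⊆ U, ∀ t ⊆ U, G s * G t ≤ G (s ∩ t) * G (s ∪ t)) :
    (∑ W ∈ U.powerset, G W * (cellWt r₁ r₂ true true W * 1)) *
        (∑ W ∈ U.powerset, G W * mWt m true W) ≤
      (∑ W ∈ U.powerset, G W) *
        (∑ W ∈ U.powerset, G W * (cellWt r₁ r₂ true true W * mWt m true W)) := by
  have := ad_indicator U G G G G (fun W => cellWt r₁ r₂ true true W * 1) (fun W => mWt m true W)
    (fun _ => 1) (fun W => cellWt r₁ r₂ true true W * mWt m true W) hG hG hG hG
    (fun W => mul_nonneg (cellWt_nonneg _ _ _ _ _) zero_le_one) (fun W => mWt_nonneg _ _ _)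
    (fun _ => zero_le_one) (fun W => mul_nonneg (cellWt_nonneg _ _ _ _ _) (mWt_nonneg _ _ _))
    (fun s t => by simpa using ind_top (R := R) r₁ r₂ m s t) (fun s hs t ht _ => wLL s hs t ht)
  simpa only [mul_one] using this

/-- **The ideal mean ordering** of the `R`-law. -/
theorem cellId (U : Finset V) (G : Finset V → R) (r₁ r₂ m : V) (hG : ∀ W, 0 ≤ G W)
    (wLL : ∀ s ⊆ U, ∀ t ⊆ U, G s * G t ≤ G (s ∩ t) * G (s ∪ t)) :
    (∑ W ∈ U.powerset, G W * (cellWt r₁ r₂ false false W * mWt m true W)) *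
        (∑ W ∈ U.powerset, G W) ≤
      (∑ W ∈ U.powerset, G W * (cellWt r₁ r₂ false false W * 1)) *
        (∑ W ∈ U.powerset, G W * mWt m true W) := by
  have := ad_indicator U G G G G (fun W => cellWt r₁ r₂ false false W * mWt m true W) (fun _ => 1)
    (fun W => cellWt r₁ r₂ false false W * 1) (fun W => mWt m true W) hG hG hG hG
    (fun W => mul_nonneg (cellWt_nonneg _ _ _ _ _) (mWt_nonneg _ _ _)) (fun _ => zero_le_one)
    (fun W => mul_nonneg (cellWt_nonneg _ _ _ _ _) zero_le_one) (fun W => mWt_nonneg _ _ _)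
    (fun s t => by simpa using ind_ideal (R := R) r₁ r₂ m s t) (fun s hs t ht _ => wLL s hs t ht)
  simpa only [mul_one] using this

/-- **The filter mean ordering** of the `R`-law. -/
theorem cellFil (U : Finset V) (G : Finset V → R) (r m : V) (hG : ∀ W, 0 ≤ G W)
    (wLL : ∀ s ⊆ U, ∀ t ⊆ U, G s * G t ≤ G (s ∩ t) * G (s ∪ t)) :
    (∑ W ∈ U.powerset, G W * mWt r true W) * (∑ W ∈ U.powerset, G W * mWt m true W) ≤
      (∑ W ∈ U.powerset, G W) * (∑ W ∈ U.powerset, G W * (mWt r true W * mWt m true W)) := by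
  have := ad_indicator U G G G G (fun W => mWt r true W) (fun W => mWt m true W) (fun _ => 1)
    (fun W => mWt r true W * mWt m true W) hG hG hG hG (fun W => mWt_nonneg _ _ _)
    (fun W => mWt_nonneg _ _ _) (fun _ => zero_le_one)
    (fun W => mul_nonneg (mWt_nonneg _ _ _) (mWt_nonneg _ _ _))
    (fun s t => by simpa using ind_filter (R := R) r m s t) (fun s hs t ht _ => wLL s hs t ht)
  simpa only [mul_one] using this

end K2AwareCells

end Summit.Ventures.PercRepro2.Coin
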